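import Summits.BirchSwinnertonDyer.BirchSwinnertonDyer.Theorems.EdixhovenFibreFiveSevenStarredOptimalManinUnitFiveSevenNIV
import Summits.BirchSwinnertonDyer.BirchSwinnertonDyer.Theorems.EdixhovenFibreFiveSevenStarredOptimalManinUnitFiveSevenKatoNeronIsogenyTransport
import Summits.BirchSwinnertonDyer.BirchSwinnertonDyer.Theorems.EdixhovenFibreFiveSevenStarredOptimalManinUnitFiveSevenKatoUnitChoiceCRT
import Summits.BirchSwinnertonDyer.BirchSwinnertonDyer.Theorems.AdditiveKolyvaginRoadManinFrameResidueProperRSemiLocalDescent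
import Literature.NumberTheory.EllipticCurves.IsogenyIdProofs
import HarnessLib

/-!
# F″ programme, the ASSEMBLY SOCKET: Kato's Néron-twisted integrality F″ ⟸ [level = conductor] + a NÉRON
# VALUE LAW WITH `p`-INTEGRAL CHARACTER SUM at one globally minimal member of each isogeny class
# (route `EdixhovenFibreFiveSeven`, crux K★ `StarredOptimalManinUnitFiveSeven`, stmt-BirchSwinnertonDyer-22226,
# line `kato-lever`; `--supports` 22226, helper)

Cell `pub/bsd-wall`, seat `bsd-line-edix-p4` g3 (WIDTH-5 attach). TOOL theorems only (no definition, no named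
fact, no `sorry`; the value law and Carayol's level fact are DISPLAYED HYPOTHESES); nothing is closed or booked;
BSD is not proved by any of this.

WHY. The registered skeleton `Cruxes/StarredOptimalManinUnitFiveSeven/Lines/kato_lever.lean` (v2) has ONE stub,
F″ = `Literature.NumberTheory.EllipticCurves.kato_neron_isIntegral_twistedSymbolSum_of_additive_five_le`
(cite-only, XL). The programme that would discharge it (`Lines/kato-lever-F2-programme.md` §4, §8;
`Cruxes/ManinFrameResidueProper/P4-ROADMAP-manin-p1-g8.md` §1) reads, once P1 (Kato (8.1.3) + Thm. 9.7 +
Thm. 6.6 (1), case `ξ ∈ SL₂(ℤ)`, + Thm. 13.6, valued in a Néron coordinate at Kato's member `E•`) is a text: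
F″ ⟸ P6-socket ∘ [P1 value law at the member] ∘ units ∘ P4-core ∘ P4-coh ∘ receptacle ∘ value exit. Every piece
but P1 and P4-coh is in the tree (P6 p597552, units p599628/p599933/p599331, P4-core p598912, receptacle
p599280/…, value exit p598918, F″ ⟸ hlev + NIV p599800). THIS FILE composes the RIGHT end once and for all:
**F″ ⟸ [Carayol] + H**, where H is EXACTLY the output of «P1 value law ∘ P4-coh ∘ receptacle ∘ P4-core» at the
member and nothing more — for every `V` under F″'s binders, SOME globally minimal `W ∼ V` such that, under `W`'s
own copy of F″'s hypotheses, for every entire continuation `L` of the `(m·pN)`-inflated series of `χ̄` and for all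
`c, d ∈ ℕ` carrying the conclusions of the unit choice (`KatoUnitChoice.exists_unitChoice_kato`: `> 1`,
`≡ 1 (mod N)`, `≡ 1 (mod p)`, prime to `6mpN`, units mod `m`, `χ ≠ 1` there), there are `q ∈ ℚ` with `p ∤ num q`
(Kato's real-structure factor times the Manin-symbol coordinate `n_ξ` of Thm. 13.6 for the consumer's `ξ`),
`μ ∈ {χ(c), χ⁻¹(c)}`, `ν ∈ {χ(d), χ⁻¹(d)}` (either reading of the bars in Thm. 6.6 (1)'s
`T = (c² − c^u χ(c))(d² − d^v χ̄(d))`) and a `p`-INTEGRAL `y` (`∃ s, p ∤ s, s·y ∈ ℤ̄`: the character sum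
`Σ_b χ̄(b) σ_b(exp*_ω z)` after P4-core) with the VALUE LAW
`y = (c² − cμ)(d² − dν) · q · L(1)/Ω⁺(W)` (`χ` even) resp. `· L(1)/(i·Ω⁻(W))` (`χ` odd).
The socket is P1-SHAPE-TOLERANT in every slot P1's final text may vary (member, `c`/`d` side conditions, which
character carries the bar, the rational unit, the order of quantifiers `∀ c d ∃ q y`).

WHAT IS PROVED.
* §1 `exists_isIntegral_of_forall_valueLaw` — pointwise: for ANY `X ∈ ℂ`, a value law `y = (c² − cμ)(d² − dν)·q·X`
  with `p`-integral `y` for all admissible `c, d` forces `X` `p`-integral (unit choice `c = d` from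
  `exists_unitChoice_kato`, division `exists_isIntegral_of_valueLaw`).
* §2 ★ `kato_neron_five_le_of_memberValueLaw` — **F″ ⟸ [level = conductor] + H** (H as above; proof: P6 socket
  `kato_neron_five_le_of_forall_exists_member'` ∘ value exit `katoNeron_{even,odd}_of_depletedValue` at the member,
  with `p ∣ N` and `a_ℓ = 0` at `ℓ² ∣ N` read off `N = N(W)` exactly as in `kato_neron_of_depletedValueIntegral`, ∘ §1).
* §2 `kato_neron_five_le_of_valueLaw` — the same with `W = V` (for a P1 stated at every curve).
* §2 `depletedValueIntegral_of_memberValueLaw` — the NIV-level form at one curve (no Carayol): H at `W` ⟹ NIV at `W`.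
* §3 ★ `kato_neron_five_le_of_memberCharSumLaw` — the same socket ONE STEP FURTHER LEFT, with P4-core
  (`SemiLocalDescent.exists_not_dvd_isIntegral_charSum_of_forall_valuation_le_one`, p598912) composed in: the
  `p`-integral `y` is replaced by Kato's RATIONAL value `x ∈ ℚ(ζ_m)` (Thm. 9.7), integral at every place `w ∣ p`
  (the receptacle ∘ P4-coh output, valuation form), an embedding `ι : ℚ(ζ_m) → ℂ` and a character `ψ` mod `m`
  (either of `χ`, `χ̄`), with the value law `charSum m ι ψ x = (c² − cμ)(d² − dν)·q·L(1)/Ω^±(W)`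
  (`charSum` = `Σ_b ψ(b)·ι(σ_b x)`, the left side of Thm. 6.6 (1)). After it: F″ ⟸ hlev + [P1 text ∘ P4-coh ∘
  receptacle], nothing else.

References: [Kato2004Asterisque] K. Kato, Astérisque 295 (2004), (8.1.3) p. 180, Thm. 9.7 p. 189, Thm. 6.6 (1)
p. 163, Thm. 13.6 p. 227; [KimNakamura2020] Cor. 2.4; [Carayol1986]; [MazurTateTeitelbaum1986] §I.8 (8.6);
programme `Cruxes/StarredOptimalManinUnitFiveSeven/Lines/kato-lever-F2-programme.md` §4/§8 and
`Cruxes/ManinFrameResidueProper/P4-ROADMAP-manin-p1-g8.md` §1/§3 (P1 socket spec (S6)).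
-/

set_option autoImplicit false
-- the Theorems namespace of a single-conjunct summit repeats the summit name by design (D-0017)
set_option linter.dupNamespace false

noncomputable section

open scoped MatrixGroups ModularForm Classical
open Complex CongruenceSubgroup WeierstrassCurve
open Literature.NumberTheory.EllipticCurves Literature.NumberTheory.EllipticCurves.ModularForms
open Literature.NumberTheory.EllipticCurves.Kato2004
open Summit.BirchSwinnertonDyer.BirchSwinnertonDyer.Theorems.StarredOptimalManinUnitFiveSevenValueExit
open Summit.BirchSwinnertonDyer.BirchSwinnertonDyer.Theorems.StarredOptimalManinUnitFiveSevenNIV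
open Summit.BirchSwinnertonDyer.BirchSwinnertonDyer.Theorems.KatoNeronIsogenyTransport
open Summit.BirchSwinnertonDyer.BirchSwinnertonDyer.Theorems.KatoUnitChoice
open Summit.BirchSwinnertonDyer.BirchSwinnertonDyer.Theorems.SemiLocalDescent
open scoped NumberField
open IsDedekindDomain

namespace Summit.BirchSwinnertonDyer.BirchSwinnertonDyer.Theorems.KatoAssemblySocket

/-! ## §1 Pointwise: a value law for all admissible `c, d` with `p`-integral left-hand side forces `X` `p`-integral -/

/-- **Pointwise division under the unit choice.** Let `p` be prime, `gcd(m, pN) = 1`, `χ ≠ 1` a Dirichlet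
character mod `m` with `p ∤ ord χ` (F″'s binders), and `X ∈ ℂ`. Suppose that for all `c, d ∈ ℕ` satisfying the
conclusions of the unit choice (`> 1`, `≡ 1 (mod N)`, `≡ 1 (mod p)`, `p ∣ c − 1` in `ℤ`, prime to `6mpN`, a unit
mod `m` with `χ(c) ≠ 1`; same for `d`) there are `q ∈ ℚ` with `p ∤ num q`, `μ ∈ {χ(c), χ⁻¹(c)}`,
`ν ∈ {χ(d), χ⁻¹(d)}` and a `p`-integral `y` with `y = (c² − cμ)(d² − dν)·q·X`. Then `X` is `p`-integral
(take `c = d` from `exists_unitChoice_kato`; Kato's factor is then a `p`-unit; divide). [folklore] -/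
theorem exists_isIntegral_of_forall_valueLaw {p : ℕ} [Fact p.Prime] {N m : ℕ} [NeZero N] [NeZero m]
    (hm : m.Coprime (p * N)) (χ : DirichletCharacter ℂ m) (hχ1 : χ ≠ 1) (hord : ¬ p ∣ orderOf χ) {X : ℂ}
    (hVL : ∀ c d : ℕ,
      (1 < c ∧ c ≡ 1 [MOD N] ∧ c ≡ 1 [MOD p] ∧ (p : ℤ) ∣ (c : ℤ) - 1 ∧ c.Coprime (6 * (m * (p * N))) ∧
        IsUnit (c : ZMod m) ∧ χ (c : ZMod m) ≠ 1) →
      (1 < d ∧ d ≡ 1 [MOD N] ∧ d ≡ 1 [MOD p] ∧ (p : ℤ) ∣ (d : ℤ) - 1 ∧ d.Coprime (6 * (m * (p * N))) ∧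
        IsUnit (d : ZMod m) ∧ χ (d : ZMod m) ≠ 1) →
      ∃ (q : ℚ) (y μ ν : ℂ), ¬ (p : ℤ) ∣ q.num ∧ (∃ s : ℕ, ¬ p ∣ s ∧ IsIntegral ℤ ((s : ℂ) * y)) ∧
        (μ = χ (c : ZMod m) ∨ μ = χ⁻¹ (c : ZMod m)) ∧ (ν = χ (d : ZMod m) ∨ ν = χ⁻¹ (d : ZMod m)) ∧
        y = ((c : ℂ) ^ 2 - (c : ℂ) * μ) * ((d : ℂ) ^ 2 - (d : ℂ) * ν) * (q : ℂ) * X) :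
    ∃ s : ℕ, ¬ p ∣ s ∧ IsIntegral ℤ ((s : ℂ) * X) := by
  obtain ⟨c, hc1, hcN, hcp, hcp', hccop, hcu, hχc, hF, hFinv⟩ := exists_unitChoice_kato hm χ hχ1 hord
  have hc : 1 < c ∧ c ≡ 1 [MOD N] ∧ c ≡ 1 [MOD p] ∧ (p : ℤ) ∣ (c : ℤ) - 1 ∧
      c.Coprime (6 * (m * (p * N))) ∧ IsUnit (c : ZMod m) ∧ χ (c : ZMod m) ≠ 1 :=
    ⟨hc1, hcN, hcp, hcp', hccop, hcu, hχc⟩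
  obtain ⟨q, y, μ, ν, hq, hy, hμ, hν, hlaw⟩ := hVL c c hc hc
  -- either reading of the bar: both `c² − cχ(c)` and `c² − cχ⁻¹(c)` are `p`-units
  have hfac : ∀ ρ : ℂ, (ρ = χ (c : ZMod m) ∨ ρ = χ⁻¹ (c : ZMod m)) →
      (c : ℂ) ^ 2 - (c : ℂ) * ρ ≠ 0 ∧
        ∃ s : ℕ, ¬ p ∣ s ∧ IsIntegral ℤ ((s : ℂ) * ((c : ℂ) ^ 2 - (c : ℂ) * ρ)⁻¹) := by
    rintro ρ (rfl | rfl)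
    · exact hF
    · exact hFinv
  obtain ⟨hμ0, hμinv⟩ := hfac μ hμ
  obtain ⟨hν0, hνinv⟩ := hfac ν hν
  have hTinv : ∃ s : ℕ, ¬ p ∣ s ∧ IsIntegral ℤ
      ((s : ℂ) * (((c : ℂ) ^ 2 - (c : ℂ) * μ) * ((c : ℂ) ^ 2 - (c : ℂ) * ν))⁻¹) := by
    rw [mul_inv]
    exact exists_isIntegral_mul hμinv hνinv
  exact exists_isIntegral_of_valueLaw (mul_ne_zero hμ0 hν0) hTinv hq hlaw hy

/-! ## §2 The assembly socket: F″ ⟸ [level = conductor] + member value law -/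

/-- **NIV at one curve from the value law at that curve (no Carayol).** For `W/ℚ` and `f, p, N, m, χ` with
`gcd(m, pN) = 1`, `χ ≠ 1`, `p ∤ ord χ`: if for every entire `L` continuing the `(m·pN)`-inflated series of `χ̄`
and all admissible `c, d` the value law with `p`-integral left-hand side holds (even: against `L(1)/Ω⁺(W)`,
odd: against `L(1)/(i·Ω⁻(W))`), then NIV holds at `W`: `L(1)/Ω⁺(W)` resp. `L(1)/(i·Ω⁻(W))` is `p`-integral for
every such `L`. [folklore] -/
theorem depletedValueIntegral_of_memberValueLaw {p : ℕ} [Fact p.Prime] (W : WeierstrassCurve ℚ) [W.IsElliptic]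
    {N m : ℕ} [NeZero N] [NeZero m] (f : CuspForm (Gamma0 N) 2) (hm : m.Coprime (p * N))
    (χ : DirichletCharacter ℂ m) (hχ1 : χ ≠ 1) (hord : ¬ p ∣ orderOf χ)
    (hVL : ∀ (L : ℂ → ℂ), EulerSystemValues.IsDepletedTwistedL f m (p * N) χ⁻¹ L →
      ∀ c d : ℕ,
      (1 < c ∧ c ≡ 1 [MOD N] ∧ c ≡ 1 [MOD p] ∧ (p : ℤ) ∣ (c : ℤ) - 1 ∧ c.Coprime (6 * (m * (p * N))) ∧
        IsUnit (c : ZMod m) ∧ χ (c : ZMod m) ≠ 1) →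
      (1 < d ∧ d ≡ 1 [MOD N] ∧ d ≡ 1 [MOD p] ∧ (p : ℤ) ∣ (d : ℤ) - 1 ∧ d.Coprime (6 * (m * (p * N))) ∧
        IsUnit (d : ZMod m) ∧ χ (d : ZMod m) ≠ 1) →
      ∃ (q : ℚ) (y μ ν : ℂ), ¬ (p : ℤ) ∣ q.num ∧ (∃ s : ℕ, ¬ p ∣ s ∧ IsIntegral ℤ ((s : ℂ) * y)) ∧
        (μ = χ (c : ZMod m) ∨ μ = χ⁻¹ (c : ZMod m)) ∧ (ν = χ (d : ZMod m) ∨ ν = χ⁻¹ (d : ZMod m)) ∧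
        (χ.Even → y = ((c : ℂ) ^ 2 - (c : ℂ) * μ) * ((d : ℂ) ^ 2 - (d : ℂ) * ν) * (q : ℂ) *
          (L 1 / (W.realPeriodRat : ℂ))) ∧
        (χ.Odd → y = ((c : ℂ) ^ 2 - (c : ℂ) * μ) * ((d : ℂ) ^ 2 - (d : ℂ) * ν) * (q : ℂ) *
          (L 1 / (Complex.I * (W.imaginaryPeriodRat : ℂ)))))
    (L : ℂ → ℂ) (hL : EulerSystemValues.IsDepletedTwistedL f m (p * N) χ⁻¹ L) :
    (χ.Even → ∃ s : ℕ, ¬ p ∣ s ∧ IsIntegral ℤ ((s : ℂ) * (L 1 / (W.realPeriodRat : ℂ)))) ∧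
    (χ.Odd → ∃ s : ℕ, ¬ p ∣ s ∧ IsIntegral ℤ ((s : ℂ) * (L 1 / (Complex.I * (W.imaginaryPeriodRat : ℂ))))) := by
  refine ⟨fun hev ↦ ?_, fun hod ↦ ?_⟩
  · refine exists_isIntegral_of_forall_valueLaw hm χ hχ1 hord fun c d hc hd ↦ ?_
    obtain ⟨q, y, μ, ν, hq, hy, hμ, hν, he, -⟩ := hVL L hL c d hc hd
    exact ⟨q, y, μ, ν, hq, hy, hμ, hν, he hev⟩
  · refine exists_isIntegral_of_forall_valueLaw hm χ hχ1 hord fun c d hc hd ↦ ?_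
    obtain ⟨q, y, μ, ν, hq, hy, hμ, hν, -, ho⟩ := hVL L hL c d hc hd
    exact ⟨q, y, μ, ν, hq, hy, hμ, hν, ho hod⟩

/-- ★ **THE ASSEMBLY SOCKET: F″ ⟸ [level = conductor] + a Néron value law with `p`-integral character sum at
one globally minimal member of each class.** Hypotheses: Carayol's «the level of the newform of `W` is `N(W)`»
(`IsNewformOf.level_eq_conductorNorm`, displayed as `hlev`; over the tree it follows from modularity,
`IsNewformOf.level_eq_conductorNorm_of_exists_isNewformOf'`), and `H`: for every `V` under F″'s binders there is
a globally minimal `W ∼ V` (Kato's member `E•`, §8.3 p. 181) such that, under `W`'s own copy of F″'s hypotheses,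
for every entire `L` with `IsDepletedTwistedL f m (p·N) χ⁻¹ L` and all `c, d` carrying the unit-choice conclusions,
`∃ q ∈ ℚ` (`p ∤ num q`), `μ ∈ {χ(c), χ⁻¹(c)}`, `ν ∈ {χ(d), χ⁻¹(d)}` and a `p`-integral `y` with
`y = (c² − cμ)(d² − dν)·q·L(1)/Ω⁺(W)` (`χ` even) resp. `·L(1)/(i·Ω⁻(W))` (`χ` odd) — Kato's Thm. 9.7 ∘ Thm. 6.6 (1)
(case `ξ ∈ SL₂(ℤ)`, `c ≡ d ≡ 1 mod N`, `T = (c² − c^uχ(c))(d² − d^vχ̄(d))`, `(u, v) = (1, 1)`) in the Néron basis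
after the receptacle (Kim–Nakamura Cor. 2.4) and the semi-local descent. Conclusion: F″. Proof: P6 socket
`kato_neron_five_le_of_forall_exists_member'` ∘ value exit `katoNeron_{even,odd}_of_depletedValue` at `W`
(`p ∣ N`, `a_ℓ(W) = 0` at `ℓ² ∣ N` from `N = N(W)`) ∘ §1.
[cite: Kato2004Asterisque, (8.1.3) (p. 180), Thm. 9.7 (p. 189), Thm. 6.6 (1) (p. 163), Thm. 13.6 (p. 227)]
[cite: KimNakamura2020, Cor. 2.4] [cite: Carayol1986] [cite: MazurTateTeitelbaum1986, §I.8 (8.6)] -/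
theorem kato_neron_five_le_of_memberValueLaw
    (hlev : ∀ {N : ℕ} [NeZero N], IsNewformOf.level_eq_conductorNorm (N := N))
    (H : ∀ (V : WeierstrassCurve ℚ) [V.IsElliptic] [V.IsGloballyMinimal] {N : ℕ} [NeZero N]
      (f : CuspForm (Gamma0 N) 2), IsNewformOf V f → ∀ (p : ℕ) [Fact p.Prime], 5 ≤ p →
      ¬ V.HasGoodReductionAtPrime p → ¬ V.HasMultiplicativeReductionAtPrime p →
      V.HasIrreducibleModPGaloisRep p → ∀ (m : ℕ) [NeZero m], m.Coprime (p * N) →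
      (7 < p ∨ (Nat.Coprime (orderOf (p : ZMod m)) (p - 1) ∧
        ∀ P : (V.baseChange ℚ_[p]).toAffine.Point, p • P = 0 → P = 0)) →
      ∀ (χ : DirichletCharacter ℂ m), χ.IsPrimitive → χ ≠ 1 → ¬ p ∣ orderOf χ →
      ∃ (W : WeierstrassCurve ℚ) (_ : W.IsElliptic) (_ : W.IsGloballyMinimal), IsIsogenous V W ∧
        (IsNewformOf W f → ¬ W.HasGoodReductionAtPrime p → ¬ W.HasMultiplicativeReductionAtPrime p →
          W.HasIrreducibleModPGaloisRep p →
          (7 < p ∨ (Nat.Coprime (orderOf (p : ZMod m)) (p - 1) ∧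
            ∀ P : (W.baseChange ℚ_[p]).toAffine.Point, p • P = 0 → P = 0)) →
        ∀ (L : ℂ → ℂ), EulerSystemValues.IsDepletedTwistedL f m (p * N) χ⁻¹ L →
        ∀ c d : ℕ,
        (1 < c ∧ c ≡ 1 [MOD N] ∧ c ≡ 1 [MOD p] ∧ (p : ℤ) ∣ (c : ℤ) - 1 ∧ c.Coprime (6 * (m * (p * N))) ∧
          IsUnit (c : ZMod m) ∧ χ (c : ZMod m) ≠ 1) →
        (1 < d ∧ d ≡ 1 [MOD N] ∧ d ≡ 1 [MOD p] ∧ (p : ℤ) ∣ (d : ℤ) - 1 ∧ d.Coprime (6 * (m * (p * N))) ∧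
          IsUnit (d : ZMod m) ∧ χ (d : ZMod m) ≠ 1) →
        ∃ (q : ℚ) (y μ ν : ℂ), ¬ (p : ℤ) ∣ q.num ∧ (∃ s : ℕ, ¬ p ∣ s ∧ IsIntegral ℤ ((s : ℂ) * y)) ∧
          (μ = χ (c : ZMod m) ∨ μ = χ⁻¹ (c : ZMod m)) ∧ (ν = χ (d : ZMod m) ∨ ν = χ⁻¹ (d : ZMod m)) ∧
          (χ.Even → y = ((c : ℂ) ^ 2 - (c : ℂ) * μ) * ((d : ℂ) ^ 2 - (d : ℂ) * ν) * (q : ℂ) *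
            (L 1 / (W.realPeriodRat : ℂ))) ∧
          (χ.Odd → y = ((c : ℂ) ^ 2 - (c : ℂ) * μ) * ((d : ℂ) ^ 2 - (d : ℂ) * ν) * (q : ℂ) *
            (L 1 / (Complex.I * (W.imaginaryPeriodRat : ℂ)))))) :
    kato_neron_isIntegral_twistedSymbolSum_of_additive_five_le := by
  refine kato_neron_five_le_of_forall_exists_member'
    fun V _ _ N _ f hf p _ hp5 hgood hmult hirr m _ hm htors χ hχ hχ1 hord ↦ ?_
  obtain ⟨W, hWE, hWM, hiso, hW⟩ := H V f hf p hp5 hgood hmult hirr m hm htors χ hχ hχ1 hord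
  refine ⟨W, hWE, hWM, hiso, fun hfW hgoodW hmultW hirrW htorsW ϖ r ↦ ?_⟩
  have hVL := hW hfW hgoodW hmultW hirrW htorsW
  -- `N = N(W)`: `p ∣ N` and `a_ℓ(W) = 0` at every `ℓ² ∣ N`
  have hN : N = W.conductorNorm ℤ := hlev hfW
  have hpN : p ∣ N := by
    rw [hN]
    exact (dvd_pow_self p two_ne_zero).trans (sq_dvd_conductorNorm_of_not_good_of_not_mult ⟨hgoodW, hmultW⟩)
  have hsq : ∀ q ∈ N.primeFactors, q ^ 2 ∣ N → W.LFunction q = 0 := fun q hq hq2 ↦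
    lFunction_eq_zero_of_sq_dvd_conductorNorm W (Nat.prime_of_mem_primeFactors hq) (hN ▸ hq2)
  -- the entire continuation of the `(m·pN)`-inflated series of `χ̄`
  haveI : NeZero (m * (p * N)) :=
    ⟨mul_ne_zero (NeZero.ne m) (mul_ne_zero (Fact.out : p.Prime).ne_zero (NeZero.ne N))⟩
  obtain ⟨L, hLd, hLs⟩ := exists_differentiable_eq_twistedLSeries_holds f
    (DirichletCharacter.changeLevel (dvd_mul_right m (p * N)) χ⁻¹)
  have hL : EulerSystemValues.IsDepletedTwistedL f m (p * N) χ⁻¹ L := ⟨hLd, hLs⟩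
  obtain ⟨heven, hodd⟩ := depletedValueIntegral_of_memberValueLaw W f hm χ hχ1 hord hVL L hL
  refine ⟨fun hev hϖ hr ↦ ?_, fun hod hϖ hr ↦ ?_⟩
  · exact katoNeron_even_of_depletedValue W hfW hpN hsq hm hχ hL (heven hev) hϖ hr
  · exact katoNeron_odd_of_depletedValue W hfW hpN hsq hm hχ hL (hodd hod) hϖ hr

/-- **The same socket for a value law stated at EVERY curve** (no member: `W = V`, `V ∼ V` by the identity
isogeny): F″ ⟸ [level = conductor] + the value law with `p`-integral character sum at `V` itself, under F″'s
binders. [cite: Kato2004Asterisque, (8.1.3) (p. 180), Thm. 9.7 (p. 189), Thm. 6.6 (1) (p. 163)]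
[cite: Carayol1986] -/
theorem kato_neron_five_le_of_valueLaw
    (hlev : ∀ {N : ℕ} [NeZero N], IsNewformOf.level_eq_conductorNorm (N := N))
    (H : ∀ (V : WeierstrassCurve ℚ) [V.IsElliptic] [V.IsGloballyMinimal] {N : ℕ} [NeZero N]
      (f : CuspForm (Gamma0 N) 2), IsNewformOf V f → ∀ (p : ℕ) [Fact p.Prime], 5 ≤ p →
      ¬ V.HasGoodReductionAtPrime p → ¬ V.HasMultiplicativeReductionAtPrime p →
      V.HasIrreducibleModPGaloisRep p → ∀ (m : ℕ) [NeZero m], m.Coprime (p * N) →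
      (7 < p ∨ (Nat.Coprime (orderOf (p : ZMod m)) (p - 1) ∧
        ∀ P : (V.baseChange ℚ_[p]).toAffine.Point, p • P = 0 → P = 0)) →
      ∀ (χ : DirichletCharacter ℂ m), χ.IsPrimitive → χ ≠ 1 → ¬ p ∣ orderOf χ →
      ∀ (L : ℂ → ℂ), EulerSystemValues.IsDepletedTwistedL f m (p * N) χ⁻¹ L →
      ∀ c d : ℕ,
      (1 < c ∧ c ≡ 1 [MOD N] ∧ c ≡ 1 [MOD p] ∧ (p : ℤ) ∣ (c : ℤ) - 1 ∧ c.Coprime (6 * (m * (p * N))) ∧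
        IsUnit (c : ZMod m) ∧ χ (c : ZMod m) ≠ 1) →
      (1 < d ∧ d ≡ 1 [MOD N] ∧ d ≡ 1 [MOD p] ∧ (p : ℤ) ∣ (d : ℤ) - 1 ∧ d.Coprime (6 * (m * (p * N))) ∧
        IsUnit (d : ZMod m) ∧ χ (d : ZMod m) ≠ 1) →
      ∃ (q : ℚ) (y μ ν : ℂ), ¬ (p : ℤ) ∣ q.num ∧ (∃ s : ℕ, ¬ p ∣ s ∧ IsIntegral ℤ ((s : ℂ) * y)) ∧
        (μ = χ (c : ZMod m) ∨ μ = χ⁻¹ (c : ZMod m)) ∧ (ν = χ (d : ZMod m) ∨ ν = χ⁻¹ (d : ZMod m)) ∧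
        (χ.Even → y = ((c : ℂ) ^ 2 - (c : ℂ) * μ) * ((d : ℂ) ^ 2 - (d : ℂ) * ν) * (q : ℂ) *
          (L 1 / (V.realPeriodRat : ℂ))) ∧
        (χ.Odd → y = ((c : ℂ) ^ 2 - (c : ℂ) * μ) * ((d : ℂ) ^ 2 - (d : ℂ) * ν) * (q : ℂ) *
          (L 1 / (Complex.I * (V.imaginaryPeriodRat : ℂ))))) :
    kato_neron_isIntegral_twistedSymbolSum_of_additive_five_le := by
  refine kato_neron_five_le_of_memberValueLaw hlev
    fun V _ _ N _ f hf p _ hp5 hgood hmult hirr m _ hm htors χ hχ hχ1 hord ↦ ?_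
  exact ⟨V, inferInstance, inferInstance, isIsogenous_self V,
    fun _ _ _ _ _ L hL c d hc hd ↦ H V f hf p hp5 hgood hmult hirr m hm htors χ hχ hχ1 hord L hL c d hc hd⟩

/-! ## §3 One step further left: the socket in Kato's RATIONAL-VALUE currency (P4-core composed in) -/

/-- ★ **THE ASSEMBLY SOCKET, rational-value form: F″ ⟸ [level = conductor] + H′**, where H′ is H of
`kato_neron_five_le_of_memberValueLaw` with the `p`-integral `y` replaced by the data P1 ∘ P4-coh ∘ receptacle
actually produce: Kato's RATIONAL value `x ∈ ℚ(ζ_m)` (Thm. 9.7: `exp*(z) = x · [f]`, `x ∈ ℚ(ζ_m)`), INTEGRAL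
AT EVERY PLACE `w ∣ p` of `ℚ(ζ_m)` (`v_w(x) ≤ 1` for every `w ∋ p`: the receptacle, Kim–Nakamura Cor. 2.4, read
on the semi-local components), an embedding `ι : ℚ(ζ_m) → ℂ`, a character `ψ` mod `m` (either of `χ`, `χ̄` —
whichever P1's page gives) and the VALUE LAW `Σ_b ψ(b)·ι(σ_b x) = (c² − cμ)(d² − dν)·q·L(1)/Ω⁺(W)` (even `χ`)
resp. `·L(1)/(i·Ω⁻(W))` (odd `χ`) — Thm. 6.6 (1), case `ξ ∈ SL₂(ℤ)`, in the Néron basis. Proof: P4-core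
(`exists_not_dvd_isIntegral_charSum_of_forall_valuation_le_one`: such an `x` has `p`-integral character sums)
then `kato_neron_five_le_of_memberValueLaw` with `y := charSum m ι ψ x`.
[cite: Kato2004Asterisque, (8.1.3) (p. 180), Thm. 9.7 (p. 189), Thm. 6.6 (1) (p. 163), Thm. 13.6 (p. 227)]
[cite: KimNakamura2020, Cor. 2.4] [cite: Carayol1986] -/
theorem kato_neron_five_le_of_memberCharSumLaw
    (hlev : ∀ {N : ℕ} [NeZero N], IsNewformOf.level_eq_conductorNorm (N := N))
    (H : ∀ (V : WeierstrassCurve ℚ) [V.IsElliptic] [V.IsGloballyMinimal] {N : ℕ} [NeZero N]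
      (f : CuspForm (Gamma0 N) 2), IsNewformOf V f → ∀ (p : ℕ) [Fact p.Prime], 5 ≤ p →
      ¬ V.HasGoodReductionAtPrime p → ¬ V.HasMultiplicativeReductionAtPrime p →
      V.HasIrreducibleModPGaloisRep p → ∀ (m : ℕ) [NeZero m], m.Coprime (p * N) →
      (7 < p ∨ (Nat.Coprime (orderOf (p : ZMod m)) (p - 1) ∧
        ∀ P : (V.baseChange ℚ_[p]).toAffine.Point, p • P = 0 → P = 0)) →
      ∀ (χ : DirichletCharacter ℂ m), χ.IsPrimitive → χ ≠ 1 → ¬ p ∣ orderOf χ →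
      ∃ (W : WeierstrassCurve ℚ) (_ : W.IsElliptic) (_ : W.IsGloballyMinimal), IsIsogenous V W ∧
        (IsNewformOf W f → ¬ W.HasGoodReductionAtPrime p → ¬ W.HasMultiplicativeReductionAtPrime p →
          W.HasIrreducibleModPGaloisRep p →
          (7 < p ∨ (Nat.Coprime (orderOf (p : ZMod m)) (p - 1) ∧
            ∀ P : (W.baseChange ℚ_[p]).toAffine.Point, p • P = 0 → P = 0)) →
        ∀ (L : ℂ → ℂ), EulerSystemValues.IsDepletedTwistedL f m (p * N) χ⁻¹ L →
        ∀ c d : ℕ,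
        (1 < c ∧ c ≡ 1 [MOD N] ∧ c ≡ 1 [MOD p] ∧ (p : ℤ) ∣ (c : ℤ) - 1 ∧ c.Coprime (6 * (m * (p * N))) ∧
          IsUnit (c : ZMod m) ∧ χ (c : ZMod m) ≠ 1) →
        (1 < d ∧ d ≡ 1 [MOD N] ∧ d ≡ 1 [MOD p] ∧ (p : ℤ) ∣ (d : ℤ) - 1 ∧ d.Coprime (6 * (m * (p * N))) ∧
          IsUnit (d : ZMod m) ∧ χ (d : ZMod m) ≠ 1) →
        ∃ (q : ℚ) (ψ : DirichletCharacter ℂ m) (ι : CyclotomicField m ℚ →+* ℂ) (x : CyclotomicField m ℚ)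
          (μ ν : ℂ), ¬ (p : ℤ) ∣ q.num ∧
          (∀ w : HeightOneSpectrum (𝓞 (CyclotomicField m ℚ)),
            (p : 𝓞 (CyclotomicField m ℚ)) ∈ w.asIdeal → w.valuation (CyclotomicField m ℚ) x ≤ 1) ∧
          (μ = χ (c : ZMod m) ∨ μ = χ⁻¹ (c : ZMod m)) ∧ (ν = χ (d : ZMod m) ∨ ν = χ⁻¹ (d : ZMod m)) ∧
          (χ.Even → EulerSystemValues.charSum m ι ψ x =
            ((c : ℂ) ^ 2 - (c : ℂ) * μ) * ((d : ℂ) ^ 2 - (d : ℂ) * ν) * (q : ℂ) *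
              (L 1 / (W.realPeriodRat : ℂ))) ∧
          (χ.Odd → EulerSystemValues.charSum m ι ψ x =
            ((c : ℂ) ^ 2 - (c : ℂ) * μ) * ((d : ℂ) ^ 2 - (d : ℂ) * ν) * (q : ℂ) *
              (L 1 / (Complex.I * (W.imaginaryPeriodRat : ℂ)))))) :
    kato_neron_isIntegral_twistedSymbolSum_of_additive_five_le := by
  refine kato_neron_five_le_of_memberValueLaw hlev
    fun V _ _ N _ f hf p _ hp5 hgood hmult hirr m _ hm htors χ hχ hχ1 hord ↦ ?_
  obtain ⟨W, hWE, hWM, hiso, hW⟩ := H V f hf p hp5 hgood hmult hirr m hm htors χ hχ hχ1 hord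
  refine ⟨W, hWE, hWM, hiso, fun hfW hgoodW hmultW hirrW htorsW L hL c d hc hd ↦ ?_⟩
  obtain ⟨q, ψ, ι, x, μ, ν, hq, hx, hμ, hν, he, ho⟩ :=
    hW hfW hgoodW hmultW hirrW htorsW L hL c d hc hd
  exact ⟨q, EulerSystemValues.charSum m ι ψ x, μ, ν, hq,
    exists_not_dvd_isIntegral_charSum_of_forall_valuation_le_one m p ι ψ x hx, hμ, hν, he, ho⟩

end Summit.BirchSwinnertonDyer.BirchSwinnertonDyer.Theorems.KatoAssemblySocket

end
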